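import Literature.NumberTheory.EllipticCurves.ComplexMultiplicationBurungaleFlachDescent
import Literature.NumberTheory.EllipticCurves.BSDQuadraticDescent
import Literature.NumberTheory.EllipticCurves.QuadraticTwistJInvariantProofs
import Literature.NumberTheory.EllipticCurves.IsogenyCompProofs
import Literature.NumberTheory.EllipticCurves.IsogenyIdProofs
import HarnessLib

/-!
# Burungale–Flach, Corollary 2: the descent `K → ℚ` from its standard inputs

Family `bsd`, trunk T-ELLARITH. The named fact
`Literature.NumberTheory.EllipticCurves.BurungaleFlach2024_bsd_rat_of_bsd_cmField` (`ComplexMultiplicationBurungaleFlachDescent.lean`)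
transcribes the proof of Burungale–Flach, Camb. J. Math. 12 (2024), Cor. 2 at `F⁺ = ℚ`: the
rank-zero Birch–Swinnerton-Dyer formula for `E_K/K` (`K` the CM field) implies the one for `E/ℚ`,
by Weil restriction (Milne 1972, Thm. 1), the isogeny `E_ε ∼ E` of a CM curve with its twist by
the character of `K/ℚ` (Milne 1972, Thm. 3), isogeny invariance of BSD and "taking square roots"
(Milne 1972, Cor. to Thm. 3). This file **derives that fact** from the generic descent theorem
`WeierstrassCurve.bsd_rat_of_bsd_imaginaryQuadratic` (`BSDQuadraticDescent.lean`: Artin formalism,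
Milne's theorem in quotient form, Cassels' isogeny invariance, the sign `L(E,1) ≥ 0` of
Guo / Lapid–Rallis, and modularity for the continuation) and the one genuinely CM input, vendored
here as a named fact:

* `Literature.NumberTheory.EllipticCurves.isIsogenous_quadraticTwist_cmFieldDiscr` — a CM elliptic curve over `ℚ` with CM by
  `𝓞_K` is `ℚ`-isogenous to its quadratic twist by `d_K` (Burungale–Flach, proof of Cor. 2:
  *"In our case `E_ε` is isogenous to `E` (see [Milne 1972, Thm. 3])"*);

with the proved consequences `isIsogenous_quadraticTwist_cmFieldDiscr_of_j_eq` (the case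
`j = 1728` of the fact, where the twist by `d_K = -4` is even `ℚ`-isomorphic to `E`:
`y² = x³ + Ax ≅ y² = x³ + 16Ax` by `u = ½`), `isIsogenous_quadraticTwist_discr_of_isCMFieldOfJ`
(the same for the twist by `disc K` of any field `K ≅ ℚ(√d_K)`),
`BurungaleFlach2024_bsd_rat_of_bsd_cmField_of_level3` (the descent fact from the level-3 facts)
and `bsdTriple_of_j_mem_maximalCMJInvariants_of_L_one_ne_zero_of_level3` (bsd.S28, verbatim form,
from Burungale–Flach Cor. 1 over `K` and the level-3 facts).

## References

* A. Burungale, M. Flach, *The conjecture of Birch and Swinnerton-Dyer for certain elliptic curves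
  with complex multiplication*, Camb. J. Math. 12 (2024), Cor. 1, Cor. 2 and its proof (arXiv p. 4).
* J. S. Milne, *On the arithmetic of abelian varieties*, Invent. Math. 17 (1972), Thm. 1, Thm. 3
  and Corollary.
* K. Ireland, M. Rosen, *A Classical Introduction to Modern Number Theory*, 2nd ed. (1990),
  Prop. 20.5.4.
* E. Lapid, S. Rallis, Ann. of Math. 157 (2003), Thm. 1; J. Guo, Duke Math. J. 83 (1996).
-/

noncomputable section

open scoped Classical

open WeierstrassCurve NumberField

namespace Literature.NumberTheory.EllipticCurves

/-! ### The CM input: `E` is isogenous to its twist by the CM field -/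

/-- **A CM elliptic curve over `ℚ` is `ℚ`-isogenous to its quadratic twist by its CM field.**
Let `E/ℚ` have complex multiplication by the maximal order `𝓞_K` of `K = ℚ(√d_K)` — over `ℚ`
the condition `j(E) ∈ maximalCMJInvariants`, with `d_K = cmFieldDiscr j(E)` — and let
`E_ε = E^{(d_K)}` be its twist by the quadratic character `ε` of `K/ℚ`. Then `E_ε` is isogenous
to `E` over `ℚ`: Burungale–Flach, Camb. J. Math. 12 (2024), proof of Cor. 2 (*"In our case `E_ε`
is isogenous to `E` (see [Milne 1972, Thm. 3])"*, `E_ε` "the twist of `E` by the quadratic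
character `ε` attached to `F/F⁺`", here `F/F⁺ = K/ℚ`); Milne, Invent. Math. 17 (1972), Thm. 3.
(The isogeny is an endomorphism `[√-m] ∈ End_K(E) = 𝓞_K`, `K = ℚ(√-m)`, composed with the
`K`-isomorphism `E ≅ E^{(d_K)}`; the composite commutes with `Gal(K/ℚ)` and descends to `ℚ` —
e.g. the `3`-isogeny `y² = x³ + b → y² = x³ - 27b` for `j = 0`, while for `j = 1728` the twist by
`d_K = -4` is even `ℚ`-isomorphic to `E`, `isIsogenous_quadraticTwist_cmFieldDiscr_of_j_eq`.) In
the tree's vocabulary: the prelude's `WeierstrassCurve.IsIsogenous` and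
`WeierstrassCurve.quadraticTwist`.
[cite: BurungaleFlach2024, proof of Cor. 2 (arXiv p. 4)]
[cite: Milne1972ArithmeticAV, Thm. 3 (through BurungaleFlach2024)] -/
def isIsogenous_quadraticTwist_cmFieldDiscr : Prop :=
  ∀ (W : WeierstrassCurve ℚ) [W.IsElliptic], W.j ∈ maximalCMJInvariants →
    IsIsogenous W (W.quadraticTwist (cmFieldDiscr W.j : ℚ))

/-- **The case `j = 1728` of `isIsogenous_quadraticTwist_cmFieldDiscr`, proved.** An elliptic
curve `E/ℚ` with `j(E) = 1728` (CM by `ℤ[i]`, `d_K = -4`) is `ℚ`-isomorphic, hence `ℚ`-isogenous,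
to its twist by `-4`: on a short model `y² = x³ + Ax` (`B = 0` since `j = 1728`,
`j = 6912A³/(4A³ + 27B²)`) the twist is `y² = x³ + 16Ax` (Silverman *AEC* X.5.4(i)), which is the
model obtained by the change of variables `u = ½`. Isogeny is transported along the isomorphisms
with the proved `IsIsogenous.refl_holds`, `IsIsogenous.smul_right`, `IsIsogenous.trans'` and
`quadraticTwist_smul`. Silverman, *AEC*, X.5 Prop. 5.4 and Exercise 10.16.
[cite: SilvermanAEC2009, X.5 Prop. 5.4] -/
theorem isIsogenous_quadraticTwist_cmFieldDiscr_of_j_eq (W : WeierstrassCurve ℚ) [W.IsElliptic]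
    (hj : W.j = 1728) : IsIsogenous W (W.quadraticTwist (cmFieldDiscr W.j : ℚ)) := by
  have hd : (cmFieldDiscr W.j : ℚ) = -4 := by rw [hj]; norm_num [cmFieldDiscr]
  rw [hd]
  -- a short model `S = C • W : y² = x³ + A x + B`, with `B = 0`
  obtain ⟨C, hC⟩ := W.exists_variableChange_isShortNF
  haveI := hC
  have hjS : (C • W).j = 1728 := by rw [variableChange_j]; exact hj
  have hB : (C • W).a₆ = 0 := by
    have hden := four_mul_a₄_cube_add_ne_zero (C • W)
    have hj' := (C • W).j_of_isShortNF
    rw [hjS, eq_div_iff hden] at hj'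
    have h27 : 27 * (C • W).a₆ ^ 2 = 0 := by linarith
    exact pow_eq_zero_iff (n := 2) (by norm_num) |>.mp (by linarith [h27] : (C • W).a₆ ^ 2 = 0)
  -- its twist by `-4` is `y² = x³ + 16 A x = (u = ½) • S`
  set C₂ : VariableChange ℚ := ⟨Units.mk0 (1 / 2 : ℚ) (by norm_num), 0, 0, 0⟩ with hC₂
  have htw : (C • W).quadraticTwist (-4) = C₂ • (C • W) := by
    rw [quadraticTwist_of_isShortNF, hB]
    ext
    · simp [hC₂, variableChange_a₁]
    · simp [hC₂, variableChange_a₂, a₂_of_isShortNF]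
    · simp [hC₂, variableChange_a₃]
    · simp only [hC₂, variableChange_a₄, a₁_of_isShortNF, a₂_of_isShortNF, a₃_of_isShortNF,
        Units.val_inv_eq_inv_val, Units.val_mk0]
      ring
    · simp only [hC₂, variableChange_a₆, a₁_of_isShortNF, a₂_of_isShortNF, a₃_of_isShortNF, hB,
        Units.val_inv_eq_inv_val, Units.val_mk0]
      ring
  -- transport: `W ≅ S ≅ S^{(-4)} = C' • W^{(-4)}`
  have h1 : IsIsogenous W (C • W) := (IsIsogenous.refl_holds W).smul_right C
  have h2 : IsIsogenous (C • W) ((C • W).quadraticTwist (-4)) := by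
    rw [htw]; exact (IsIsogenous.refl_holds (C • W)).smul_right C₂
  have h3 : IsIsogenous W ((C • W).quadraticTwist (-4)) := h1.trans' h2
  rw [quadraticTwist_smul] at h3
  have h4 := h3.smul_right (⟨C.u, (-4) * C.r, 0, 0⟩ : VariableChange ℚ)⁻¹
  rwa [inv_smul_smul] at h4

/-- The same for the twist by the discriminant `disc K` of any number field `K` with
`IsCMFieldOfJ K j(E)` (i.e. `K ≅ ℚ(√d_K)`): `disc K = d_K q²` for a rational `q ≠ 0`
(`NumberField.exists_discr_eq_mul_sq`), and `E^{(d_K q²)} ≅ E^{(d_K)}` over `ℚ`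
(`exists_variableChange_quadraticTwist_mul_sq`), isogeny being stable under isomorphisms of the
target (`IsIsogenous.smul_right`). [cite: BurungaleFlach2024, proof of Cor. 2 (arXiv p. 4)] -/
theorem isIsogenous_quadraticTwist_discr_of_isCMFieldOfJ
    (hTW : isIsogenous_quadraticTwist_cmFieldDiscr)
    (W : WeierstrassCurve ℚ) [W.IsElliptic] (hj : W.j ∈ maximalCMJInvariants)
    (K : Type) [Field K] [NumberField K] (hK : IsCMFieldOfJ K W.j) :
    IsIsogenous W (W.quadraticTwist (NumberField.discr K : ℚ)) := by
  obtain ⟨θ, hθ⟩ := hK.2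
  have hd : cmFieldDiscr W.j < 0 := cmFieldDiscr_neg hj
  have hθ' : θ ∉ Set.range (algebraMap ℚ K) := by
    rintro ⟨q, hq⟩
    have h1 : (algebraMap ℚ K) (q ^ 2) = (algebraMap ℚ K) (cmFieldDiscr W.j : ℚ) := by
      rw [map_pow, hq, hθ, map_intCast]
    have h2 : q ^ 2 = (cmFieldDiscr W.j : ℚ) := (algebraMap ℚ K).injective h1
    have h3 : (0 : ℚ) ≤ q ^ 2 := sq_nonneg q
    have h4 : ((cmFieldDiscr W.j : ℤ) : ℚ) < 0 := by exact_mod_cast hd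
    linarith
  have hc : θ ^ 2 = algebraMap ℚ K (cmFieldDiscr W.j : ℚ) := by rw [hθ, map_intCast]
  obtain ⟨q, hq, hdisc⟩ := NumberField.exists_discr_eq_mul_sq hK.1 hθ' hc
  obtain ⟨C, hC⟩ := W.exists_variableChange_quadraticTwist_mul_sq (cmFieldDiscr W.j : ℚ) q hq
  rw [hdisc, ← hC]
  exact (hTW W hj).smul_right C

/-! ### The descent fact from the level-3 facts -/

/-- **Burungale–Flach's descent (`BurungaleFlach2024_bsd_rat_of_bsd_cmField`) from its standard
inputs.** The named fact "rank-zero BSD for `E_K/K` ⇒ rank-zero BSD for `E/ℚ`" (Burungale–Flach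
2024, proof of Cor. 2 = Milne 1972, Cor. to Thm. 3, for CM curves over `ℚ`) follows from:
modularity (`hmod`, continuation of `L(E,s)` and `L(E^{(D)},s)`, BCDT 2001), Artin formalism
(`hBCL`, Ireland–Rosen Prop. 20.5.4(b)), Milne's theorem on the BSD quotient of a Weil
restriction (`hBC`), Cassels–Tate isogeny invariance of the BSD quotient (`hISO`), Knapp 11.67
(`hKn`, isogenous curves have the same `L`-function), the non-negativity `L(E,1) ≥ 0` (`hPOS`,
Guo 1996 / Lapid–Rallis 2003, Thm. 1 — the sign when "taking square roots"), and the CM isogeny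
`E ∼ E^{(d_K)}` (`hTW`, Milne 1972, Thm. 3), via the proved generic descent
`WeierstrassCurve.bsd_rat_of_bsd_imaginaryQuadratic` (the CM field is imaginary quadratic,
`IsCMFieldOfJ.isTotallyComplex`). [cite: BurungaleFlach2024, proof of Cor. 2 (arXiv p. 4)]
[cite: Milne1972ArithmeticAV, Thm. 1, Thm. 3 and Corollary (through BurungaleFlach2024)] -/
theorem BurungaleFlach2024_bsd_rat_of_bsd_cmField_of_level3
    (hmod : hasEntireLFunction_rat) (hBCL : LSeries_baseChange_quadratic)
    (hBC : bsdRHS_baseChange_quadratic) (hISO : bsdRHS_eq_of_isIsogenous)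
    (hKn : LFunction_eq_of_isIsogenous) (hPOS : re_entireLFunction_one_nonneg)
    (hTW : isIsogenous_quadraticTwist_cmFieldDiscr) :
    BurungaleFlach2024_bsd_rat_of_bsd_cmField := by
  intro W _ _ hj hL K _ _ hK W' _ _ hW' hBSDK
  haveI : IsTotallyComplex K := hK.isTotallyComplex hj
  exact bsd_rat_of_bsd_imaginaryQuadratic hmod hBCL hBC hISO hKn hPOS W K hK.1
    (isIsogenous_quadraticTwist_discr_of_isCMFieldOfJ hTW W hj K hK) W' hW' hBSDK.1 hBSDK.2.1
    hBSDK.2.2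

/-- **bsd.S28 (verbatim form) from Burungale–Flach Cor. 1 over `K` and the level-3 facts.**
`bsdTriple_of_j_mem_maximalCMJInvariants_of_L_one_ne_zero` follows from Corollary 1 over the CM
field (`h₁ = BurungaleFlach2024_bsd_cmField`, the terminal CM input: Rubin/Johnson-Leung–Kings
main conjecture + Kato's reciprocity law + Burungale–Flach's descent at every prime) and the
seven standard facts of `BurungaleFlach2024_bsd_rat_of_bsd_cmField_of_level3`, through the
level-2 assembly `bsdTriple_of_j_mem_maximalCMJInvariants_of_L_one_ne_zero_of_level2` (class
number one of the nine CM fields and global minimal models over a PID, both proved).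
[cite: BurungaleFlach2024, Thm 1.1, Cor. 1, Cor. 2 (arXiv pp. 3–4)] -/
theorem bsdTriple_of_j_mem_maximalCMJInvariants_of_L_one_ne_zero_of_level3
    (h₁ : BurungaleFlach2024_bsd_cmField)
    (hmod : hasEntireLFunction_rat) (hBCL : LSeries_baseChange_quadratic)
    (hBC : bsdRHS_baseChange_quadratic) (hISO : bsdRHS_eq_of_isIsogenous)
    (hKn : LFunction_eq_of_isIsogenous) (hPOS : re_entireLFunction_one_nonneg)
    (hTW : isIsogenous_quadraticTwist_cmFieldDiscr) :
    bsdTriple_of_j_mem_maximalCMJInvariants_of_L_one_ne_zero :=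
  bsdTriple_of_j_mem_maximalCMJInvariants_of_L_one_ne_zero_of_level2 h₁
    (BurungaleFlach2024_bsd_rat_of_bsd_cmField_of_level3 hmod hBCL hBC hISO hKn hPOS hTW)

end Literature.NumberTheory.EllipticCurves

end
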